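import Summits.Ventures.PercRepro.GenQClassTwelveSeventeenB

/-!
# PercRepro — the top trace counts at every corank: the general forms of parts D and H (night-4, gen 15)

On an `n`-point set `G` of the core (rank `7`, hyperplane traces spanning), the `(n−2)`-traces — the hyperplanes missing
exactly two points of `G` — are the top of the trace profile, and they constrain every smaller trace count:
* two `(n−2)`-traces meet in a rank-`5` flat `F` with `n−4` or `n−3` points of `G` (`inter_top_pair`), and then
  NO `s`-trace exists for `15 ≤ s ≤ n−3` (`hypTr_eq_zero_of_two_le_top`): such a trace contains `F`
  (`s + f − n ≥ 11`); for `s ≤ n−4` its trace would be `F ∩ G` (not spanning), and for `s = n−3` its point outside `F`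
  lies in one of the two traces (`f = n−4`, `mem_or_mem_of_outside`) which it then equals, or (`f = n−3`) its trace is
  `F ∩ G` again;
* three `(n−2)`-traces force `f = n−3` and kill the `14`-traces as well (`hypTr_eq_zero_of_three_le_top`);
* ONE `(n−2)`-trace `K` leaves at most two `s`-traces for every `s` with `2s > n + 12`, `s ≤ n−3`
  (`hypTr_le_two_of_top_pos`): all of them meet `K` in the SAME rank-`5` flat (two share `≥ 2s−n` points, `≥ 2s−n−2`
  of them in `K`) and each is determined by its trace outside `K`, a subset of the two points of `G ∖ K` of one
  common size.
At `n = 19` these are parts D (`s = 15, 16`; `14` with three `17`-traces) and H (`s = 16`); at `n = 20` they give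
`h₁₈ ≥ 2 ⇒ h₁₇ = h₁₆ = h₁₅ = 0`, `h₁₈ = 3 ⇒ h₁₄ = 0`, `h₁₈ ≥ 1 ⇒ h₁₇ ≤ 2`; at `n = 21`: `h₁₉ ≥ 2 ⇒ h₁₈ = … = h₁₅ = 0`,
`h₁₉ ≥ 1 ⇒ h₁₈, h₁₇ ≤ 2`.
* an `(n−2)`-trace next to two `(n−3)`-traces (`n ≥ 19`) forces the common flat to have `n−4` points and kills every
  `s`-trace for `15 ≤ s ≤ n−4` (`hypTr_eq_zero_of_top_pos_two_le_next`): at `n = 20`, `h₁₈ ≥ 1 ∧ h₁₇ ≥ 2 ⇒ h₁₆ = h₁₅ = 0`.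
Imports `GenQClassTwelveSeventeenB` (parts A–D, H).
-/
namespace PercRepro.Night4

open Finset ThmH SixFour GenQ PerFlat Star

variable {α : Type*} [DecidableEq α] {M : Matroid α} [M.Finite]

/-- Two distinct `(n−2)`-traces (`n ≥ 15`) meet in a rank-`5` flat with `n−4` or `n−3` points of `G`. -/
theorem inter_top_pair (hB : ∀ a ≤ 7 - 3, ∀ K ∈ flatsQ M a, K.card ≤ 10) {G K K' : Finset α} {n : ℕ}
    (hcard : G.card = n) (hn : 15 ≤ n) (hK : K ∈ flatsTr M G 6 (n - 2)) (hK' : K' ∈ flatsTr M G 6 (n - 2))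
    (hne : K ≠ K') :
    K ∩ K' ∈ flatsQ M 5 ∧ n - 4 ≤ ((K ∩ K') ∩ G).card ∧ ((K ∩ K') ∩ G).card ≤ n - 3 := by
  obtain ⟨hF, h1, h2⟩ := exists_card_inter_of_two_traces hB hK hK' hne (by omega)
  exact ⟨hF, by omega, by omega⟩

/-- **Two `(n−2)`-traces leave no `s`-trace for `15 ≤ s ≤ n−3`** (the general part D). -/
theorem hypTr_eq_zero_of_two_le_top (hs : Simple M) (hline : ∀ L ∈ flatsQ M 2, L.card ≤ 3)
    (hplane : ∀ P ∈ flatsQ M 3, P.card ≤ 6) (hsolid : ∀ F ∈ flatsQ M 4, F.card ≤ 10) {G : Finset α} {n s : ℕ}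
    (hG : G ⊆ gr M) (hcard : G.card = n) (hs15 : 15 ≤ s) (hsn : s + 3 ≤ n) (h2 : 2 ≤ hypTr M G 6 (n - 2)) :
    hypTr M G 6 s = 0 := by
  have hB := flats_le_four_card_le_ten hs hline hplane hsolid
  unfold hypTr at h2 ⊢
  obtain ⟨K, K', hK, hK', hne⟩ := Finset.one_lt_card_iff.1 (by omega : 1 < (flatsTr M G 6 (n - 2)).card)
  obtain ⟨hF, hf1, hf2⟩ := inter_top_pair hB hcard (by omega) hK hK' hne
  have hK1 := mem_flatsTr.1 hK
  have hK1' := mem_flatsTr.1 hK'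
  rw [Finset.card_eq_zero, Finset.eq_empty_iff_forall_notMem]
  intro H hH
  have hH1 := mem_flatsTr.1 hH
  have hFH : K ∩ K' ⊆ H := subset_of_card_add_card hB hF hH (by omega)
  have hFGH : (K ∩ K') ∩ G ⊆ H ∩ G := by
    intro x hx
    rw [Finset.mem_inter] at hx ⊢
    exact ⟨hFH hx.1, hx.2⟩
  have hle := Finset.card_le_card hFGH
  -- a trace of size `≤ f` inside `F ∩ G` is `F ∩ G`: not spanning
  have hbig : ((K ∩ K') ∩ G).card < s := by
    by_contra hnot
    rw [not_lt] at hnot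
    have heq : (K ∩ K') ∩ G = H ∩ G := Finset.eq_of_subset_of_card_le hFGH (by omega)
    exact not_subset_of_mem_flatsTr_six hF hH (by rw [← heq]; exact Finset.inter_subset_left)
  -- so `s = n − 3` and `f = n − 4`: the point of the trace outside `F` lies in `K` or `K'`
  have hf : ((K ∩ K') ∩ G).card = n - 4 := by omega
  obtain ⟨x, hxH, hxF⟩ := Finset.not_subset.1 (not_subset_of_mem_flatsTr_six hF hH)
  rw [Finset.mem_inter] at hxH
  have hxE : x ∈ M.E := by
    rw [← coe_gr M]
    exact Finset.mem_coe.2 (hG hxH.2)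
  rcases mem_or_mem_of_outside hK hK' (by omega) hxH.2 hxF with hxK | hxK'
  · exact ne_of_mem_flatsTr_of_card_ne hH hK (by omega)
      (eq_of_mem_of_subset_flatsQ_six hF hH1.1 hK1.1 hFH Finset.inter_subset_left hxE hxF hxH.1 hxK)
  · exact ne_of_mem_flatsTr_of_card_ne hH hK' (by omega)
      (eq_of_mem_of_subset_flatsQ_six hF hH1.1 hK1'.1 hFH Finset.inter_subset_right hxE hxF hxH.1 hxK')

/-- Three `(n−2)`-traces (`n ≥ 17`) meet pairwise in `n−3` points: with `f = n−4` every point outside `F` lies in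
the first two traces, and the third would be one of them. -/
theorem card_inter_eq_of_three_top (hs : Simple M) (hline : ∀ L ∈ flatsQ M 2, L.card ≤ 3)
    (hplane : ∀ P ∈ flatsQ M 3, P.card ≤ 6) (hsolid : ∀ F ∈ flatsQ M 4, F.card ≤ 10) {G K K' K'' : Finset α}
    {n : ℕ} (hG : G ⊆ gr M) (hcard : G.card = n) (hn : 17 ≤ n) (hK : K ∈ flatsTr M G 6 (n - 2))
    (hK' : K' ∈ flatsTr M G 6 (n - 2)) (hK'' : K'' ∈ flatsTr M G 6 (n - 2)) (hne : K ≠ K') (hne' : K ≠ K'')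
    (hne'' : K' ≠ K'') : ((K ∩ K') ∩ G).card = n - 3 := by
  have hB := flats_le_four_card_le_ten hs hline hplane hsolid
  obtain ⟨hF, hf1, hf2⟩ := inter_top_pair hB hcard (by omega) hK hK' hne
  have hK1 := mem_flatsTr.1 hK
  have hK1' := mem_flatsTr.1 hK'
  have hK1'' := mem_flatsTr.1 hK''
  by_contra hne3
  have hf : ((K ∩ K') ∩ G).card = n - 4 := by omega
  have hFK'' : K ∩ K' ⊆ K'' := subset_of_card_add_card hB hF hK'' (by omega)
  obtain ⟨x, hxK'', hxF⟩ := Finset.not_subset.1 (not_subset_of_mem_flatsTr_six hF hK'')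
  rw [Finset.mem_inter] at hxK''
  have hxE : x ∈ M.E := by
    rw [← coe_gr M]
    exact Finset.mem_coe.2 (hG hxK''.2)
  rcases mem_or_mem_of_outside hK hK' (by omega) hxK''.2 hxF with hxK | hxK'
  · exact hne' (eq_of_mem_of_subset_flatsQ_six hF hK1.1 hK1''.1 Finset.inter_subset_left hFK'' hxE hxF hxK
      hxK''.1)
  · exact hne'' (eq_of_mem_of_subset_flatsQ_six hF hK1'.1 hK1''.1 Finset.inter_subset_right hFK'' hxE hxF hxK'
      hxK''.1)

/-- **Three `(n−2)`-traces leave no `s`-trace for `14 ≤ s ≤ n−3`** (the general part D, third statement). -/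
theorem hypTr_eq_zero_of_three_le_top (hs : Simple M) (hline : ∀ L ∈ flatsQ M 2, L.card ≤ 3)
    (hplane : ∀ P ∈ flatsQ M 3, P.card ≤ 6) (hsolid : ∀ F ∈ flatsQ M 4, F.card ≤ 10) {G : Finset α} {n s : ℕ}
    (hG : G ⊆ gr M) (hcard : G.card = n) (hs14 : 14 ≤ s) (hsn : s + 3 ≤ n) (h3 : 3 ≤ hypTr M G 6 (n - 2)) :
    hypTr M G 6 s = 0 := by
  have hB := flats_le_four_card_le_ten hs hline hplane hsolid
  unfold hypTr at h3 ⊢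
  obtain ⟨K, K', K'', hK, hK', hK'', hne, hne', hne''⟩ :=
    Finset.two_lt_card_iff.1 (by omega : 2 < (flatsTr M G 6 (n - 2)).card)
  obtain ⟨hF, -, -⟩ := inter_top_pair hB hcard (by omega) hK hK' hne
  have hf := card_inter_eq_of_three_top hs hline hplane hsolid hG hcard (by omega) hK hK' hK'' hne hne' hne''
  rw [Finset.card_eq_zero, Finset.eq_empty_iff_forall_notMem]
  intro H hH
  have hH1 := mem_flatsTr.1 hH
  have hFH : K ∩ K' ⊆ H := subset_of_card_add_card hB hF hH (by omega)
  have hFGH : (K ∩ K') ∩ G ⊆ H ∩ G := by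
    intro x hx
    rw [Finset.mem_inter] at hx ⊢
    exact ⟨hFH hx.1, hx.2⟩
  have hle := Finset.card_le_card hFGH
  have heq : (K ∩ K') ∩ G = H ∩ G := Finset.eq_of_subset_of_card_le hFGH (by omega)
  exact not_subset_of_mem_flatsTr_six hF hH (by rw [← heq]; exact Finset.inter_subset_left)

/-- An `s`-trace (`s ≤ n−3`, `s ≥ 13`) meets an `(n−2)`-trace in a rank-`5` flat with `s−2 … s−1` points of `G`. -/
theorem inter_top_trace (hB : ∀ a ≤ 7 - 3, ∀ K ∈ flatsQ M a, K.card ≤ 10) {G K L : Finset α} {n s : ℕ}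
    (hcard : G.card = n) (hs13 : 13 ≤ s) (hsn : s + 3 ≤ n) (hK : K ∈ flatsTr M G 6 (n - 2))
    (hL : L ∈ flatsTr M G 6 s) :
    K ∩ L ∈ flatsQ M 5 ∧ s - 2 ≤ ((K ∩ L) ∩ G).card ∧ ((K ∩ L) ∩ G).card + 1 ≤ s := by
  have hne : K ≠ L := ne_of_mem_flatsTr_of_card_ne hK hL (by omega)
  obtain ⟨hF, hlo⟩ := inter_mem_flatsQ_five_of_two_traces hB hK hL hne (by omega)
  refine ⟨hF, by omega, ?_⟩
  by_contra hbig
  have hL1 := mem_flatsTr.1 hL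
  have hsub : (K ∩ L) ∩ G ⊆ L ∩ G := by
    intro x hx
    rw [Finset.mem_inter] at hx ⊢
    exact ⟨(Finset.mem_inter.1 hx.1).2, hx.2⟩
  have heq : (K ∩ L) ∩ G = L ∩ G := Finset.eq_of_subset_of_card_le hsub (by omega)
  exact not_subset_of_mem_flatsTr_six hF hL (by rw [← heq]; exact Finset.inter_subset_left)

/-- Two `s`-traces with `2s > n + 12` meet an `(n−2)`-trace `K` in the SAME rank-`5` flat: they share `≥ 2s−n`
points of `G`, `≥ 2s−n−2 > 10` of them in `K`. -/
theorem inter_top_eq_inter_top (hB : ∀ a ≤ 7 - 3, ∀ K ∈ flatsQ M a, K.card ≤ 10) {G K L L' : Finset α} {n s : ℕ}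
    (hcard : G.card = n) (hs : n + 12 < 2 * s) (hsn : s + 3 ≤ n) (hK : K ∈ flatsTr M G 6 (n - 2))
    (hL : L ∈ flatsTr M G 6 s) (hL' : L' ∈ flatsTr M G 6 s) : K ∩ L = K ∩ L' := by
  have hK1 := mem_flatsTr.1 hK
  obtain ⟨hFL, -, -⟩ := inter_top_trace hB hcard (by omega) hsn hK hL
  obtain ⟨hFL', -, -⟩ := inter_top_trace hB hcard (by omega) hsn hK hL'
  have h2s := two_mul_sub_le_card_inter_of_mem_flatsTr hL hL'
  have hD : (G \ K).card = 2 := by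
    rw [Finset.card_sdiff, hK1.2.1, hcard]
    omega
  have hsub : (L ∩ L') ∩ G ⊆ ((K ∩ L) ∩ (K ∩ L')) ∪ (G \ K) := by
    intro x hx
    simp only [Finset.mem_inter] at hx
    simp only [Finset.mem_union, Finset.mem_inter, Finset.mem_sdiff]
    by_cases hxK : x ∈ K
    · exact Or.inl ⟨⟨hxK, hx.1.1⟩, ⟨hxK, hx.1.2⟩⟩
    · exact Or.inr ⟨hx.2, hxK⟩
  have h11 : 11 ≤ ((K ∩ L) ∩ (K ∩ L')).card := by
    have h1 := Finset.card_le_card hsub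
    have h2 := Finset.card_union_le ((K ∩ L) ∩ (K ∩ L')) (G \ K)
    omega
  by_contra hneF
  have hnot : ¬ K ∩ L ⊆ K ∩ L' := fun hsub' => hneF (eq_of_subset_of_mem_flatsQ hFL hFL' hsub')
  obtain ⟨b, hFF, hb⟩ := exists_inter_mem_flatsQ_lt_of_not_subset hFL (mem_flatsQ.1 hFL').2.1 hnot
  have := hB b (by omega) _ hFF
  omega

/-- **One `(n−2)`-trace leaves at most two `s`-traces for every `s` with `2s > n + 12`, `s ≤ n−3`** (the general
part H): all `s`-traces contain one rank-`5` flat `F ⊆ K` and are determined by their traces outside `K`, subsets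
of the two points of `G ∖ K` of the common size `s − |F ∩ G|`. -/
theorem hypTr_le_two_of_top_pos (hs : Simple M) (hline : ∀ L ∈ flatsQ M 2, L.card ≤ 3)
    (hplane : ∀ P ∈ flatsQ M 3, P.card ≤ 6) (hsolid : ∀ F ∈ flatsQ M 4, F.card ≤ 10) {G : Finset α} {n s : ℕ}
    (hcard : G.card = n) (hs2 : n + 12 < 2 * s) (hsn : s + 3 ≤ n) (h1 : 1 ≤ hypTr M G 6 (n - 2)) :
    hypTr M G 6 s ≤ 2 := by
  have hB := flats_le_four_card_le_ten hs hline hplane hsolid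
  unfold hypTr at h1 ⊢
  obtain ⟨K, hK⟩ := Finset.card_pos.1 (by omega : 0 < (flatsTr M G 6 (n - 2)).card)
  by_contra hlt
  rw [not_le] at hlt
  obtain ⟨L₁, L₂, L₃, hL₁, hL₂, hL₃, h12, h13, h23⟩ := Finset.two_lt_card_iff.1 hlt
  have hK1 := mem_flatsTr.1 hK
  have hD : (G \ K).card = 2 := by
    rw [Finset.card_sdiff, hK1.2.1, hcard]
    omega
  have hF12 := inter_top_eq_inter_top hB hcard hs2 hsn hK hL₁ hL₂
  have hF13 := inter_top_eq_inter_top hB hcard hs2 hsn hK hL₁ hL₃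
  have hmem : ∀ L ∈ flatsTr M G 6 s, K ∩ L = K ∩ L₁ →
      (L ∩ G) \ K ∈ (G \ K).powersetCard (s - ((K ∩ L₁) ∩ G).card) := by
    intro L hL hKL
    have hL1 := mem_flatsTr.1 hL
    refine Finset.mem_powersetCard.2 ⟨?_, ?_⟩
    · intro x hx
      rw [Finset.mem_sdiff, Finset.mem_inter] at hx
      exact Finset.mem_sdiff.2 ⟨hx.1.2, hx.2⟩
    · rw [card_sdiff_trace, hL1.2.1, hKL]
  have hdist : ∀ L ∈ flatsTr M G 6 s, ∀ L' ∈ flatsTr M G 6 s, K ∩ L = K ∩ L' →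
      (L ∩ G) \ K = (L' ∩ G) \ K → L = L' := by
    intro L hL L' hL' hKL hS
    refine eq_of_inter_eq_of_mem_flatsTr hL hL' ?_
    rw [inter_eq_union_sdiff (K := K) (L := L), inter_eq_union_sdiff (K := K) (L := L'), hKL, hS]
  have hS1 := hmem L₁ hL₁ rfl
  have hS2 := hmem L₂ hL₂ hF12.symm
  have hS3 := hmem L₃ hL₃ hF13.symm
  have hne12 : (L₁ ∩ G) \ K ≠ (L₂ ∩ G) \ K := fun h => h12 (hdist L₁ hL₁ L₂ hL₂ hF12 h)
  have hne13 : (L₁ ∩ G) \ K ≠ (L₃ ∩ G) \ K := fun h => h13 (hdist L₁ hL₁ L₃ hL₃ hF13 h)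
  have hne23 : (L₂ ∩ G) \ K ≠ (L₃ ∩ G) \ K := fun h => h23 (hdist L₂ hL₂ L₃ hL₃ (hF12.symm.trans hF13) h)
  have hthree : 2 < ((G \ K).powersetCard (s - ((K ∩ L₁) ∩ G).card)).card :=
    Finset.two_lt_card_iff.2 ⟨_, _, _, hS1, hS2, hS3, hne12, hne13, hne23⟩
  rw [Finset.card_powersetCard, hD] at hthree
  have hk : s - ((K ∩ L₁) ∩ G).card ≤ 2 := by
    have := Finset.card_le_card (Finset.mem_powersetCard.1 hS1).1
    rw [(Finset.mem_powersetCard.1 hS1).2, hD] at this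
    exact this
  generalize s - ((K ∩ L₁) ∩ G).card = k at hthree hk
  interval_cases k <;> simp at hthree

/-- Two distinct `(n−3)`-traces next to an `(n−2)`-trace `K` (`n ≥ 19`) meet `K` in a rank-`5` flat with exactly
`n−4` points of `G`: they share the flat, and with `n−5` points both would have the whole `G ∖ K` outside `K`. -/
theorem card_inter_top_eq_of_two_next (hB : ∀ a ≤ 7 - 3, ∀ K ∈ flatsQ M a, K.card ≤ 10) {G K L L' : Finset α}
    {n : ℕ} (hcard : G.card = n) (hn : 19 ≤ n) (hK : K ∈ flatsTr M G 6 (n - 2)) (hL : L ∈ flatsTr M G 6 (n - 3))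
    (hL' : L' ∈ flatsTr M G 6 (n - 3)) (hne : L ≠ L') : ((K ∩ L) ∩ G).card = n - 4 := by
  have hK1 := mem_flatsTr.1 hK
  have hL1 := mem_flatsTr.1 hL
  have hL1' := mem_flatsTr.1 hL'
  obtain ⟨hF, hf1, hf2⟩ := inter_top_trace hB hcard (by omega) (by omega) hK hL
  have hFF := inter_top_eq_inter_top hB hcard (by omega) (by omega) hK hL hL'
  have hD : (G \ K).card = 2 := by
    rw [Finset.card_sdiff, hK1.2.1, hcard]
    omega
  by_contra hne4
  have hf : ((K ∩ L) ∩ G).card = n - 5 := by omega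
  -- both outside parts are the whole `G ∖ K`
  have hout : ∀ H ∈ flatsTr M G 6 (n - 3), K ∩ H = K ∩ L → (H ∩ G) \ K = G \ K := by
    intro H hH hKH
    have hH1 := mem_flatsTr.1 hH
    refine Finset.eq_of_subset_of_card_le ?_ ?_
    · intro x hx
      rw [Finset.mem_sdiff, Finset.mem_inter] at hx
      exact Finset.mem_sdiff.2 ⟨hx.1.2, hx.2⟩
    · rw [card_sdiff_trace, hH1.2.1, hKH, hf, hD]
      omega
  have h1 := hout L hL rfl
  have h2 := hout L' hL' hFF.symm
  refine hne (eq_of_inter_eq_of_mem_flatsTr hL hL' ?_)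
  rw [inter_eq_union_sdiff (K := K) (L := L), inter_eq_union_sdiff (K := K) (L := L'), ← hFF, h1, h2]

/-- **An `(n−2)`-trace and two `(n−3)`-traces leave no `s`-trace for `15 ≤ s ≤ n−4`** (`n ≥ 19`): the common
rank-`5` flat has `n−4` points and lies in every such trace, whose trace is then `F ∩ G` — not spanning. -/
theorem hypTr_eq_zero_of_top_pos_two_le_next (hs : Simple M) (hline : ∀ L ∈ flatsQ M 2, L.card ≤ 3)
    (hplane : ∀ P ∈ flatsQ M 3, P.card ≤ 6) (hsolid : ∀ F ∈ flatsQ M 4, F.card ≤ 10) {G : Finset α} {n s : ℕ}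
    (hcard : G.card = n) (hs15 : 15 ≤ s) (hsn : s + 4 ≤ n) (h1 : 1 ≤ hypTr M G 6 (n - 2))
    (h2 : 2 ≤ hypTr M G 6 (n - 3)) : hypTr M G 6 s = 0 := by
  have hB := flats_le_four_card_le_ten hs hline hplane hsolid
  unfold hypTr at h1 h2 ⊢
  obtain ⟨K, hK⟩ := Finset.card_pos.1 (by omega : 0 < (flatsTr M G 6 (n - 2)).card)
  obtain ⟨L, L', hL, hL', hne⟩ := Finset.one_lt_card_iff.1 (by omega : 1 < (flatsTr M G 6 (n - 3)).card)
  obtain ⟨hF, -, -⟩ := inter_top_trace hB hcard (by omega) (by omega) hK hL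
  have hf := card_inter_top_eq_of_two_next hB hcard (by omega) hK hL hL' hne
  rw [Finset.card_eq_zero, Finset.eq_empty_iff_forall_notMem]
  intro H hH
  have hH1 := mem_flatsTr.1 hH
  have hFH : K ∩ L ⊆ H := subset_of_card_add_card hB hF hH (by omega)
  have hFGH : (K ∩ L) ∩ G ⊆ H ∩ G := by
    intro x hx
    rw [Finset.mem_inter] at hx ⊢
    exact ⟨hFH hx.1, hx.2⟩
  have hle := Finset.card_le_card hFGH
  have heq : (K ∩ L) ∩ G = H ∩ G := Finset.eq_of_subset_of_card_le hFGH (by omega)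
  exact not_subset_of_mem_flatsTr_six hF hH (by rw [← heq]; exact Finset.inter_subset_left)

end PercRepro.Night4
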